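import Literature.NumberTheory.EllipticCurves.ModularJacobianModPMultiplicityOne
import Literature.NumberTheory.EllipticCurves.PAdicLFunctionDistributionProofs
import Literature.NumberTheory.EllipticCurves.ModularSymbolsPlusMinus
import HarnessLib

/-!
# Crux `ThetaLayerLambdaCongruenceAtTwo` (stmt-BirchSwinnertonDyer-20688, route ResidualThetaTransportAtTwo), line
# `birth` v9, stub (C3k), plan ITEM B5 (Lines/birth-C3k-plan.md): COMPLEX CONJUGATION IS NOT THE IDENTITY ON
# `Λ/𝔪Λ` — the SPINE, via evaluation at a real Hecke eigenform (width seat bsd-wall-rtt-p3-w3 g3;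
# `--supports stmt-BirchSwinnertonDyer-20688 --as helper`; closes nothing)

HONEST FRAMING. Theorems about the tree's period homology `Λ = periodHomology M ⊂ S₂(Γ₀(M))^∨`, its Hecke module
structure `periodHomologyHecke M` over `𝕋 = HeckeRing0 M 2`, and the period lattice `Λ_g = periodLattice g` of ONE
cusp form `g`. No definition, no named fact, no Jacobian, no Galois representation. Nothing about any elliptic curve
is asserted; BSD is not proved by any of this.

WHAT. ITEM B5 asks why `Δ_W < 0` is load-bearing in (C3k): the star involution `c : γ ↦ εγε` (`ε = diag(−1, 1)`;
the tree's `iotaConj`) must act NON-trivially on `Λ/𝔪Λ` for the eigen-ideal `𝔪 ∋ 2`. This file reduces that to a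
statement about ONE complex lattice, with no `c`-action on the tree's analytic `J0 M` and no Galois module:

* `cuspSymbol_iotaConj`, `periodFunctional_iotaConj_apply` (§1): for `g` with REAL Fourier coefficients,
  `{∞, (εγε)∞}_g = conj {∞, γ∞}_g` — evaluation at `g`, `ev_g : Λ → Λ_g`, intertwines the star involution with
  complex conjugation (Manin 1972 §1.6; Cremona 1997 §2.6; the tree's `modularSymbol_neg_eq_conj_holds`).
* `apply_mem_two_mul_of_mem_ideal_smul` (§2): if every element of an ideal `𝔪 ⊆ 𝕋` acts on `g` by an EVEN integer
  (e.g. `𝔪 = (2, T_q − a_q, U_ℓ)` and `g` the depleted eigenform with `T_q g = a_q g`, `U_ℓ g = 0`; see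
  `forall_mem_span_exists_even` for the generator-to-ideal bookkeeping and `forall_mem_heckeRing0_exists_int` for
  "integer eigenvalues on the generators `T_p` ⇒ on all of `𝕋`"), then `ev_g(𝔪Λ) ⊆ 2Λ_g`.
* `exists_periodFunctional_iotaConj_add_notMem_ideal_smul` (§3, THE SPINE): under the two hypotheses above, if
  `Λ_g` is RHOMBIC — some `z ∈ Λ_g` has `z + z̄ ∉ 2Λ_g` — then some `γ ∈ Γ₀(M)` has
  `{∞,(εγε)∞} + {∞,γ∞} ∉ 𝔪 • Λ`, i.e. `c ≠ 1` on `Λ/𝔪Λ` (as `2 ∈ 𝔪`, `c + 1 ≢ 0 ⟺ c − 1 ≢ 0`); also in the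
  `𝔪 • ⊤ ≤ periodHomologyHecke M` spelling (`…_notMem_ideal_smul_top`).
So B5 ⟸ «the period lattice of the depleted real eigenform is rhombic»; «`Δ < 0` ⇒ the Néron lattice is rhombic»
is the tree's `PeriodPair.IsReal.discr_pos_of_half_sum_notMem` (sibling file `…StarRhombicLattice`).

References: [Manin1972] §1.6; [CremonaAlgorithms1997] §2.6, §2.8, §2.10 (pp. 29–30, rectangular/rhombic period
lattices); [DarmonDiamondTaylor1995] §1.3 (Hecke action on `S₂^∨` by duality, `Λ` stable).
-/

noncomputable section

-- justification: the `Summit.BirchSwinnertonDyer.BirchSwinnertonDyer.…` path repeats a component (route-file convention)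
set_option linter.dupNamespace false

open scoped MatrixGroups ComplexConjugate

open CongruenceSubgroup
open Literature.NumberTheory.EllipticCurves Literature.NumberTheory.EllipticCurves.ModularForms

namespace Summit.BirchSwinnertonDyer.BirchSwinnertonDyer.Theorems.ThetaLayerLambdaCongruenceAtTwo

/-! ## §1. The star involution `γ ↦ εγε` and complex conjugation of periods -/

section Star

variable {M : ℕ} [NeZero M]

omit [NeZero M] in
/-- The star of `γ ∈ Γ₀(M)`: `εγε = (a, −b; −c, d) ∈ Γ₀(M)` (the tree's `iotaConj`, which normalises `Γ₀(M)`).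
[cite: Manin1972, §1.6] -/
theorem iotaConj_coe_mem_gamma0 (γ : Gamma0 M) : iotaConj (γ : SL(2, ℤ)) ∈ Gamma0 M :=
  iotaConj_mem_gamma0 γ.2

omit [NeZero M] in
/-- Entries of the star: `(εγε)₀₀ = γ₀₀`. [folklore] -/
theorem iotaConj_apply_00 (γ : SL(2, ℤ)) : (iotaConj γ) 0 0 = γ 0 0 := rfl

omit [NeZero M] in
/-- Entries of the star: `(εγε)₁₀ = −γ₁₀`. [folklore] -/
theorem iotaConj_apply_10 (γ : SL(2, ℤ)) : (iotaConj γ) 1 0 = -γ 1 0 := rfl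

/-- **`{∞, (εγε)∞}_g = conj {∞, γ∞}_g` for `g` with real Fourier coefficients** (`(εγε)∞ = −γ∞` and
`{∞, −r}_g = conj {∞, r}_g`, the tree's `modularSymbol_neg_eq_conj_holds`; Manin 1972 §1.6, Cremona 1997 §2.6).
[cite: Manin1972, §1.6] -/
theorem cuspSymbol_iotaConj (g : CuspForm (Gamma0 M) 2) (hreal : ∀ n, (cuspCoeff g n).im = 0) (γ : Gamma0 M) :
    cuspSymbol g ⟨iotaConj (γ : SL(2, ℤ)), iotaConj_coe_mem_gamma0 γ⟩ = conj (cuspSymbol g γ) := by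
  unfold cuspSymbol
  have h00 : (((⟨iotaConj (γ : SL(2, ℤ)), iotaConj_coe_mem_gamma0 γ⟩ : Gamma0 M) : SL(2, ℤ)) 0 0) = (γ : SL(2, ℤ)) 0 0 :=
    rfl
  have h10 : (((⟨iotaConj (γ : SL(2, ℤ)), iotaConj_coe_mem_gamma0 γ⟩ : Gamma0 M) : SL(2, ℤ)) 1 0) =
      -((γ : SL(2, ℤ)) 1 0) := rfl
  rw [h00, h10]
  by_cases hc : (γ : SL(2, ℤ)) 1 0 = 0
  · rw [if_pos hc, if_pos (neg_eq_zero.mpr hc), map_zero]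
  · rw [if_neg hc, if_neg (neg_eq_zero.not.mpr hc), ← modularSymbol_neg_eq_conj_holds g hreal, Int.cast_neg,
      div_neg]

/-- The period functional of the star, evaluated at a real-coefficient form: `{∞,(εγε)∞}(g) = conj ({∞,γ∞}(g))`.
[cite: Manin1972, §1.6] -/
theorem periodFunctional_iotaConj_apply (g : CuspForm (Gamma0 M) 2) (hreal : ∀ n, (cuspCoeff g n).im = 0)
    (γ : Gamma0 M) :
    periodFunctional M ⟨iotaConj (γ : SL(2, ℤ)), iotaConj_coe_mem_gamma0 γ⟩ g = conj (periodFunctional M γ g) := by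
  rw [periodFunctional_apply, periodFunctional_apply, cuspSymbol_iotaConj g hreal γ]

/-- Evaluation at `g` maps the period homology onto the period lattice of `g`: `λ(g) ∈ Λ_g` for `λ ∈ Λ`
(the tree's `periodLattice_eq_map_periodHomology`; Cremona 1997 §2.10). [cite: CremonaAlgorithms1997, §2.10] -/
theorem apply_mem_periodLattice (g : CuspForm (Gamma0 M) 2) {φ : Module.Dual ℂ (CuspForm (Gamma0 M) 2)}
    (hφ : φ ∈ periodHomology M) : φ g ∈ periodLattice g := by
  rw [periodLattice_eq_map_periodHomology]
  exact ⟨φ, hφ, rfl⟩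

/-- Every period of `g` is `{∞, γ∞}_g` for a single `γ ∈ Γ₀(M)` (Manin's homomorphism property; the tree's
`coe_periodHomology_eq_range`). [cite: CremonaAlgorithms1997, Lemma 2.1.1] -/
theorem exists_eq_cuspSymbol_of_mem_periodLattice (g : CuspForm (Gamma0 M) 2) {z : ℂ} (hz : z ∈ periodLattice g) :
    ∃ γ : Gamma0 M, z = cuspSymbol g γ := by
  rw [periodLattice_eq_map_periodHomology] at hz
  obtain ⟨φ, hφ, rfl⟩ := hz
  have hφ' : φ ∈ (periodHomology M : Set (Module.Dual ℂ (CuspForm (Gamma0 M) 2))) := hφ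
  rw [coe_periodHomology_eq_range] at hφ'
  obtain ⟨γ, rfl⟩ := hφ'
  exact ⟨γ, rfl⟩

/-- The period lattice of a real-coefficient form is conjugation-stable (`conj {∞,γ∞} = {∞,(εγε)∞}`).
[cite: Manin1972, §1.6] -/
theorem conj_mem_periodLattice_of_real (g : CuspForm (Gamma0 M) 2) (hreal : ∀ n, (cuspCoeff g n).im = 0)
    {z : ℂ} (hz : z ∈ periodLattice g) : conj z ∈ periodLattice g := by
  obtain ⟨γ, rfl⟩ := exists_eq_cuspSymbol_of_mem_periodLattice g hz
  rw [← cuspSymbol_iotaConj g hreal γ]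
  exact cuspSymbol_mem_periodLattice g _

end Star

/-! ## §2. An ideal acting on `g` by even integers sends `Λ` into `2Λ_g` under evaluation at `g` -/

section Ideal

variable {M : ℕ} [NeZero M]

/-- **Integer eigenvalues on the generators propagate to the whole Hecke ring.** If every `T_p` (`p` prime; `U_p` for
`p ∣ M`) acts on `g` by an integer, then every `t ∈ 𝕋 = ℤ[T_p : p prime]` does (`𝕋 = Algebra.adjoin ℤ {T_p}`,
Darmon–Diamond–Taylor §4.1). [cite: DarmonDiamondTaylor1995, §4.1 (p. 107)] -/
theorem forall_mem_heckeRing0_exists_int (g : CuspForm (Gamma0 M) 2)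
    (hT : ∀ (p : ℕ) (hp : p.Prime), ∃ a : ℤ, (haveI : NeZero p := ⟨hp.ne_zero⟩; heckeT (Gamma0 M) 2 p) g = (a : ℂ) • g)
    (t : HeckeRing0 M 2) : ∃ a : ℤ, HeckeRing0.toEnd M 2 t g = (a : ℂ) • g := by
  have ht : HeckeRing0.toEnd M 2 t ∈ Algebra.adjoin ℤ (heckeRing0Generators M 2) := HeckeRing0.toEnd_mem M 2 t
  generalize HeckeRing0.toEnd M 2 t = s at ht
  induction ht using Algebra.adjoin_induction with
  | mem x hx =>
    obtain ⟨p, hp, rfl⟩ := hx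
    exact hT p hp
  | algebraMap r =>
    refine ⟨r, ?_⟩
    rw [Algebra.algebraMap_eq_smul_one, LinearMap.smul_apply, Module.End.one_apply, Int.cast_smul_eq_zsmul]
  | add x y _ _ hx hy =>
    obtain ⟨a, ha⟩ := hx
    obtain ⟨b, hb⟩ := hy
    exact ⟨a + b, by rw [LinearMap.add_apply, ha, hb, Int.cast_add, add_smul]⟩
  | mul x y _ _ hx hy =>
    obtain ⟨a, ha⟩ := hx
    obtain ⟨b, hb⟩ := hy
    exact ⟨b * a, by rw [Module.End.mul_apply, hb, map_smul, ha, smul_smul, Int.cast_mul]⟩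

/-- **Even on the generators, integral everywhere ⇒ even on the ideal.** If every element of `𝕋` acts on `g` by an
integer and every generator `s ∈ G` of `𝔪 = Ideal.span G` acts by an EVEN integer, then every element of `𝔪` acts by
an even integer. [folklore] -/
theorem forall_mem_span_exists_even (g : CuspForm (Gamma0 M) 2) {G : Set (HeckeRing0 M 2)}
    (hall : ∀ t : HeckeRing0 M 2, ∃ a : ℤ, HeckeRing0.toEnd M 2 t g = (a : ℂ) • g)
    (hG : ∀ s ∈ G, ∃ e : ℤ, HeckeRing0.toEnd M 2 s g = ((2 * e : ℤ) : ℂ) • g) :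
    ∀ t ∈ Ideal.span G, ∃ e : ℤ, HeckeRing0.toEnd M 2 t g = ((2 * e : ℤ) : ℂ) • g := by
  intro t ht
  induction ht using Submodule.span_induction with
  | mem x hx => exact hG x hx
  | zero => exact ⟨0, by simp⟩
  | add x y _ _ hx hy =>
    obtain ⟨a, ha⟩ := hx
    obtain ⟨b, hb⟩ := hy
    refine ⟨a + b, ?_⟩
    rw [map_add, LinearMap.add_apply, ha, hb, ← add_smul, ← Int.cast_add]
    congr 2
    ring
  | smul r x _ hx =>
    obtain ⟨a, ha⟩ := hall r
    obtain ⟨e, he⟩ := hx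
    refine ⟨a * e, ?_⟩
    rw [smul_eq_mul, map_mul, Module.End.mul_apply, he, map_smul, ha, smul_smul, ← Int.cast_mul]
    congr 2
    ring

/-- **`ev_g(𝔪 • Λ) ⊆ 2Λ_g`.** If every element of the ideal `𝔪 ⊆ 𝕋` acts on `g` by an even integer, then every
`φ ∈ 𝔪 • Λ` (`Λ = periodHomologyHecke M`, Hecke action by duality `(t • φ)(g) = φ(t g)`) has `φ(g) = 2w` with
`w ∈ Λ_g`. [cite: DarmonDiamondTaylor1995, §1.3 (p. 32)] -/
theorem apply_mem_two_mul_of_mem_ideal_smul (g : CuspForm (Gamma0 M) 2) (𝔪 : Ideal (HeckeRing0 M 2))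
    (h𝔪 : ∀ t ∈ 𝔪, ∃ e : ℤ, HeckeRing0.toEnd M 2 t g = ((2 * e : ℤ) : ℂ) • g)
    {φ : Module.Dual ℂ (CuspForm (Gamma0 M) 2)} (hφ : φ ∈ 𝔪 • periodHomologyHecke M) :
    ∃ w ∈ periodLattice g, φ g = 2 * w := by
  refine Submodule.smul_induction_on (p := fun φ ↦ ∃ w ∈ periodLattice g, φ g = 2 * w) hφ ?_ ?_
  · intro t ht ψ hψ
    obtain ⟨e, he⟩ := h𝔪 t ht
    refine ⟨e * ψ g, ?_, ?_⟩
    · have := AddSubgroup.zsmul_mem (periodLattice g) (apply_mem_periodLattice g ((mem_periodHomologyHecke M).mp hψ)) e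
      rwa [← Int.cast_smul_eq_zsmul ℂ, smul_eq_mul] at this
    · rw [HeckeRing0.smul_dual_apply, he, map_smul, smul_eq_mul, Int.cast_mul, Int.cast_ofNat]
      ring
  · intro x y hx hy
    obtain ⟨a, ha, hxa⟩ := hx
    obtain ⟨b, hb, hyb⟩ := hy
    exact ⟨a + b, add_mem ha hb, by rw [LinearMap.add_apply, hxa, hyb, mul_add]⟩

end Ideal

/-! ## §3. The spine: a rhombic period lattice forces `c ≠ 1` on `Λ/𝔪Λ` -/

section Spine

variable {M : ℕ} [NeZero M]

/-- **ITEM B5, SPINE.** Let `g ∈ S₂(Γ₀(M))` have real Fourier coefficients and let `𝔪 ⊆ 𝕋 = HeckeRing0 M 2` be an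
ideal all of whose elements act on `g` by even integers. If the period lattice `Λ_g` is RHOMBIC — some `z ∈ Λ_g` has
`z + z̄ ∉ 2Λ_g` — then the star involution is not the identity on `Λ/𝔪Λ`: there is `γ ∈ Γ₀(M)` with
`{∞,(εγε)∞} + {∞,γ∞} ∉ 𝔪 • Λ` (the sum, equivalently the difference since `2Λ ⊆ 𝔪Λ` when `2 ∈ 𝔪`). Proof:
`z = {∞,γ∞}_g`; evaluation at `g` sends `𝔪 • Λ` into `2Λ_g` (§2) and `{∞,(εγε)∞}` to `z̄` (§1).
[cite: CremonaAlgorithms1997, §2.10 (pp. 29–30)] -/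
theorem exists_periodFunctional_iotaConj_add_notMem_ideal_smul (g : CuspForm (Gamma0 M) 2)
    (hreal : ∀ n, (cuspCoeff g n).im = 0) (𝔪 : Ideal (HeckeRing0 M 2))
    (h𝔪 : ∀ t ∈ 𝔪, ∃ e : ℤ, HeckeRing0.toEnd M 2 t g = ((2 * e : ℤ) : ℂ) • g)
    (hrh : ∃ z ∈ periodLattice g, ∀ w ∈ periodLattice g, z + conj z ≠ 2 * w) :
    ∃ γ : Gamma0 M, periodFunctional M ⟨iotaConj (γ : SL(2, ℤ)), iotaConj_coe_mem_gamma0 γ⟩ + periodFunctional M γ ∉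
      𝔪 • periodHomologyHecke M := by
  obtain ⟨z, hz, hzw⟩ := hrh
  obtain ⟨γ, rfl⟩ := exists_eq_cuspSymbol_of_mem_periodLattice g hz
  refine ⟨γ, fun hmem ↦ ?_⟩
  obtain ⟨w, hw, hw2⟩ := apply_mem_two_mul_of_mem_ideal_smul g 𝔪 h𝔪 hmem
  rw [LinearMap.add_apply, periodFunctional_iotaConj_apply g hreal, periodFunctional_apply, add_comm] at hw2
  exact hzw w hw hw2

/-- The same in the `𝔪 • ⊤ ≤ Λ` spelling (submodules of the `𝕋`-module `periodHomologyHecke M` itself): the element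
`{∞,(εγε)∞} + {∞,γ∞}` of `Λ` does not lie in `𝔪 • ⊤`. [cite: CremonaAlgorithms1997, §2.10 (pp. 29–30)] -/
theorem exists_periodFunctional_iotaConj_add_notMem_ideal_smul_top (g : CuspForm (Gamma0 M) 2)
    (hreal : ∀ n, (cuspCoeff g n).im = 0) (𝔪 : Ideal (HeckeRing0 M 2))
    (h𝔪 : ∀ t ∈ 𝔪, ∃ e : ℤ, HeckeRing0.toEnd M 2 t g = ((2 * e : ℤ) : ℂ) • g)
    (hrh : ∃ z ∈ periodLattice g, ∀ w ∈ periodLattice g, z + conj z ≠ 2 * w) :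
    ∃ γ : Gamma0 M, (⟨periodFunctional M ⟨iotaConj (γ : SL(2, ℤ)), iotaConj_coe_mem_gamma0 γ⟩ + periodFunctional M γ,
        add_mem ((mem_periodHomologyHecke M).mpr (periodFunctional_mem_periodHomology M _))
          ((mem_periodHomologyHecke M).mpr (periodFunctional_mem_periodHomology M γ))⟩ : periodHomologyHecke M) ∉
      𝔪 • (⊤ : Submodule (HeckeRing0 M 2) (periodHomologyHecke M)) := by
  obtain ⟨γ, hγ⟩ := exists_periodFunctional_iotaConj_add_notMem_ideal_smul g hreal 𝔪 h𝔪 hrh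
  refine ⟨γ, fun hmem ↦ hγ ?_⟩
  have := Submodule.mem_map_of_mem (f := (periodHomologyHecke M).subtype) hmem
  rwa [Submodule.map_smul'', Submodule.map_top, Submodule.range_subtype] at this

/-- **Contrapositive reading (what B6 consumes).** Under the same hypotheses, every additive map `F` on the dual space
that kills `𝔪 • Λ` and is EVEN (`F{∞,(εγε)∞} = F{∞,γ∞}` for all `γ`) … is constrained through a `c`-NON-trivial
quotient: concretely, it is not the case that `{∞,(εγε)∞} − {∞,γ∞} ∈ 𝔪 • Λ` for all `γ`, provided `2 ∈ 𝔪`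
(then `2Λ ⊆ 𝔪Λ` and sum/difference agree mod `𝔪Λ`). [cite: CremonaAlgorithms1997, §2.10 (pp. 29–30)] -/
theorem exists_periodFunctional_iotaConj_sub_notMem_ideal_smul (g : CuspForm (Gamma0 M) 2)
    (hreal : ∀ n, (cuspCoeff g n).im = 0) (𝔪 : Ideal (HeckeRing0 M 2)) (h2 : (2 : HeckeRing0 M 2) ∈ 𝔪)
    (h𝔪 : ∀ t ∈ 𝔪, ∃ e : ℤ, HeckeRing0.toEnd M 2 t g = ((2 * e : ℤ) : ℂ) • g)
    (hrh : ∃ z ∈ periodLattice g, ∀ w ∈ periodLattice g, z + conj z ≠ 2 * w) :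
    ∃ γ : Gamma0 M, periodFunctional M ⟨iotaConj (γ : SL(2, ℤ)), iotaConj_coe_mem_gamma0 γ⟩ - periodFunctional M γ ∉
      𝔪 • periodHomologyHecke M := by
  obtain ⟨γ, hγ⟩ := exists_periodFunctional_iotaConj_add_notMem_ideal_smul g hreal 𝔪 h𝔪 hrh
  refine ⟨γ, fun hmem ↦ hγ ?_⟩
  have h2γ : (2 : HeckeRing0 M 2) • periodFunctional M γ ∈ 𝔪 • periodHomologyHecke M :=
    Submodule.smul_mem_smul h2 ((mem_periodHomologyHecke M).mpr (periodFunctional_mem_periodHomology M γ))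
  have e : periodFunctional M ⟨iotaConj (γ : SL(2, ℤ)), iotaConj_coe_mem_gamma0 γ⟩ + periodFunctional M γ =
      (periodFunctional M ⟨iotaConj (γ : SL(2, ℤ)), iotaConj_coe_mem_gamma0 γ⟩ - periodFunctional M γ) +
        (2 : HeckeRing0 M 2) • periodFunctional M γ := by
    rw [show (2 : HeckeRing0 M 2) = (2 : ℕ) • (1 : HeckeRing0 M 2) by norm_num, smul_assoc, one_smul, two_nsmul]
    abel
  rw [e]
  exact add_mem hmem h2γ

end Spine

end Summit.BirchSwinnertonDyer.BirchSwinnertonDyer.Theorems.ThetaLayerLambdaCongruenceAtTwo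

end
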